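import Literature.Topology.Immersions.OrientedPlaneBundleLine
import Literature.AlgebraicTopology.CharacteristicClasses.LineEulerClass
import HarnessLib

/-!
# The Euler class of an oriented plane bundle and of the normal bundle of an immersed 4-manifold in ℝ⁶

Topic `Literature/Topology/Immersions`. Assembly of the bridge from the tree's elementary
projection-field bundles to its characteristic-class theory: an oriented rank-`2` bundle
`E = E(P)` in `M × ℝᵐ` is a complex line bundle (`ProjBundle.lineCore`,
`OrientedPlaneBundleLine.lean`), so it has an **Euler class `e(E, o) ∈ H²(M; ℤ)`**, the Euler
class (= first Chern class) of that line bundle in the sense of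
`Literature.AlgebraicTopology.CharacteristicClasses.eulerClass` (`LineEulerClass.lean`; Milnor–
Stasheff §9, §14 p. 158: `c₁ = e` for complex line bundles; Kirby, *The Topology of 4-Manifolds*
(1989), Ch. II p. 21: "`2`-plane bundles over `M` are classified by `e ∈ H²(M; ℤ)`"). In
particular the normal bundle `ν_f` of a `C^∞` immersion `f : M⁴ → ℝ⁶` of an oriented `4`-manifold,
oriented by `NormalBundleOrientation.lean`, has an Euler class `e(ν_f) ∈ H²(M; ℤ)` — the class
`χ` of Kirby's Ch. VI ("immerse `M` in `R⁶` with normal Euler class `χ`").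

* `ProjBundle.eulerClassOf P o ho : singularCohomology ℤ ℤ M 2`;
* `normalEulerClass hk hf himm oM : singularCohomology ℤ ℤ M 2` (`k = 2`).

Definitions only (data); the comparison theorems (independence of auxiliary choices, naturality,
`e = PD[zero locus]`) are the business of later files. No named facts are introduced.

## References

* J. Milnor, J. Stasheff, *Characteristic Classes* (1974), §9, §14 p. 158. [MilnorStasheff1974]
* R. C. Kirby, *The Topology of 4-Manifolds*, LNM 1374 (1989), Ch. II p. 21, Ch. VI. [Kirby1989]
-/

open scoped Manifold ContDiff Topology
open Set Function Module Bundle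

noncomputable section

namespace Literature.Topology.Immersions

/-- Local notation: `𝔼 n` is the model Euclidean space `EuclideanSpace ℝ (Fin n)`. -/
local notation "𝔼 " n:arg => EuclideanSpace ℝ (Fin n)

open Literature.AlgebraicTopology.CharacteristicClasses (eulerClass)
open Literature.AlgebraicTopology.SingularHomology (singularCohomology)
open Literature.Topology.FourManifolds (SmoothOrientation)

namespace ProjBundle

variable {n m : ℕ} {M : Type} [TopologicalSpace M] [T2Space M] [ParacompactSpace M]
  [ChartedSpace (𝔼 n) M]

/-- `ℂ` is a complex line. [folklore] -/
theorem finrank_complex_self : finrank ℂ ℂ = 1 := Module.finrank_self ℂ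

/-- **The Euler class `e(E, o) ∈ H²(M; ℤ)` of an oriented plane bundle**: the Euler class
(first Chern class) of the complex line bundle `lineCore P o ho`.
[cite: MilnorStasheff1974, §14 p. 158; Kirby1989, Ch. II p. 21] -/
def eulerClassOf (P : ProjBundle n m 2 M) (o : ∀ x, Orientation ℝ (P.fibre x) (Fin 2))
    (ho : P.IsOrientation o) : singularCohomology ℤ ℤ M 2 :=
  eulerClass ℂ (P.lineCore o ho).Fiber finrank_complex_self ℤ 1

end ProjBundle

/-- **The normal Euler class `e(ν_f) ∈ H²(M; ℤ)`** of a `C^∞` immersion `f : M → ℝ^q`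
(`2 + n = q`) of an oriented `n`-manifold: the Euler class of the normal bundle
`ProjBundle.normal` with the orientation `normalOrientation` ("`TM ⊕ ν = ℝ^q`").
[cite: Kirby1989, Ch. VI p. 40; MilnorStasheff1974, §14 p. 158] -/
def normalEulerClass {n q : ℕ} {M : Type} [TopologicalSpace M] [T2Space M] [ParacompactSpace M]
    [ChartedSpace (𝔼 n) M] [IsManifold (𝓡 n) ∞ M] (hk : 2 + n = q) {f : M → 𝔼 q}
    (hf : ContMDiff (𝓡 n) (𝓡 q) ∞ f) (himm : ∀ x, Injective (mfderiv (𝓡 n) (𝓡 q) f x))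
    (oM : SmoothOrientation (𝓡 n) M) : singularCohomology ℤ ℤ M 2 :=
  (ProjBundle.normal hk f hf himm).eulerClassOf (normalOrientation hk hf himm oM)
    (isOrientation_normalOrientation hk hf himm oM)

end Literature.Topology.Immersions
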